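import Literature.NumberTheory.Automorphic.FLSModularityLiftingTheorem
import Literature.NumberTheory.Automorphic.CDTTheorem722SerreLevelProofs
import Literature.NumberTheory.EllipticCurves.IsogenyFrobeniusTraceHoldsProofs
import Literature.NumberTheory.GaloisRepresentations.CyclotomicDeterminantImageProofs
import Literature.NumberTheory.EllipticCurves.SkinnerUrban2014.SemistableCurvesProofs
import Literature.NumberTheory.EllipticCurves.NonvanishingTwistsWaldspurgerOfHoffsteinLuo
import Literature.NumberTheory.EllipticCurves.GlobalMinimalModelProofs
import Literature.NumberTheory.EllipticCurves.MatarNekovar2019.IrreducibleOverQuadraticFieldClauseThreeProofs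
import Literature.NumberTheory.EllipticCurves.LFunctionSmulProofs
import Literature.NumberTheory.GaloisRepresentations.OddSubgroupCartanNormalizerGL2Fp
import Literature.NumberTheory.Automorphic.FLSResidualImageCriteria
import Literature.NumberTheory.EllipticCurves.SerreOpenImageDeterminantProofs
import Literature.NumberTheory.Automorphic.KisinTaylorWilesHypothesisFive
import Literature.NumberTheory.EllipticCurves.OrdinaryReductionTorsionLineProofs
import Literature.NumberTheory.EllipticCurves.NewformOpenImageGaloisProofs
import Literature.NumberTheory.Automorphic.EllipticCurveRatCuspidalRepProofs
import Literature.NumberTheory.Automorphic.GLnAdelicStructureProofs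
import Literature.NumberTheory.EllipticCurves.HasseWeilGoodReductionProofs
import Literature.NumberTheory.Automorphic.BCDTModularityModPProofs
import Literature.NumberTheory.Automorphic.Sweep1PotentialModularity
import Mathlib.LinearAlgebra.Eigenspace.Triangularizable
import HarnessLib

/-!
# Stub-ideation k = 2, GENERATION 3 (home family 2 = RESHAPE) for `stub_liftFive` of crux
# `FreyModularity` (stmt-ABC-11340, route ABC/DefiniteXi, line `Lines/Sketch.lean`)

Generation-3 re-cut of the gen-2 k2 companion (`STUB_IDEAS_stub_liftFive_2.lean`): every helper
that the tree can now PROVE is proved here, so that each plan's residual debt is one named lemma.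
* Plan A (carrier reshape to FLS Thm. 2 at `K = ℚ`, `p = 5`): A1 (`√5 → ζ₅`) is now PROVED from
  the tree's odd-form Cartan lemma `FLS2015.exists_le_normalizer_unitGroup_adjoinElem` via the
  pure linear-algebra lemma A1-grp (common `𝔽̄₅`-eigenvector of `𝔽₅[g₀]`, PROVED) and the
  `ℚ(√5)`-side lemma A1-sqrt (PROVED); A1-curve PROVED from a conjugation-invariance lemma
  (PROVED); D1 PROVED; D2′ (residual Hilbert-modularity of a modular curve's `E[5]`) PROVED;
  D4 PROVED modulo D4a.  Residual debt of the congruence road: **D4a only** (+ trust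
  `FLS2015_theorem2`, ES, Carayol).
* Plan B (carrier reshape to Serre's conjecture, canonical local datum): the weight hypothesis B2
  PROVED (gen 2) and the KW road re-threaded at the canonical datum, B1″, PROVED here (Step 2 of
  `CDTTheorem722SerreProofs` with `nonempty_localRestrictionAt` replaced by the canonical datum);
  hence `BCDT.IsModular W` for EVERY elliptic `W/ℚ` and the stub, SORRY-FREE, from the named facts
  {`khare_wintenberger`, conductor compatibility `hN`, Eichler–Shimura, Carayol}
  (`stub_liftFive_of_KW`: axioms `propext, Classical.choice, Quot.sound` only) — WITHOUT
  `CDT_theorem_7_2_2`.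
* `Sig` = the registered stub verbatim; closers `stub_liftFive_of_planA`, `stub_liftFive_of_KW`,
  `stub_liftFive_of_CDT722`.  `lean check`: rc 0, ONE sorry (D4a).
-/

set_option linter.dupNamespace false

noncomputable section

open scoped NumberField Polynomial MatrixGroups Matrix
open NumberField Polynomial IsDedekindDomain Filter
open Literature.NumberTheory.GaloisRepresentations
open Literature.NumberTheory.Automorphic
open Literature.NumberTheory.Automorphic.BCDT
open Literature.NumberTheory.EllipticCurves Literature.NumberTheory.EllipticCurves.ModularForms
open WeierstrassCurve

namespace Summit.ABC.ABC.Cruxes.FreyModularity.StubIdeas.LiftFive2g3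

/-- The registered stub `stub_liftFive`, verbatim. -/
def Sig : Prop :=
  ∀ (W : WeierstrassCurve ℚ) [W.IsElliptic] (ρ : ModPGaloisRep ℚ (ZMod 5) 2),
    W.IsTorsionGaloisRep 5 ρ → ρ.IsAbsIrreducibleOverSqrt 5 → ¬ 25 ∣ W.conductorNorm ℤ →
    ρ.IsModular → W.IsModularGaloisRepTate 5

/-! ## Plan A — `FLS2015_theorem2` at `K = ℚ`, `p = 5`

### A1 = `√5 → ζ₅`, via the tree's odd-form Cartan lemma (FLS 2015, Lemma 3.2) -/

/-- **A1-grp (PROVED; pure linear algebra).** If every square-determinant element of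
`G ≤ GL₂(𝔽_p)` lies in the unit group of the plane algebra `𝔽_p[g₀]`, then the square-determinant
part of `G` has a common eigenvector over `𝔽̄_p` (an eigenvector of `g₀`). -/
theorem exists_common_eigenvector_of_mem_unitGroup_adjoinElem {p : ℕ} [Fact p.Prime]
    {G : Subgroup (GL (Fin 2) (ZMod p))} {g₀ : GL (Fin 2) (ZMod p)}
    (hmem : ∀ g ∈ G, IsSquare (g : Matrix (Fin 2) (Fin 2) (ZMod p)).det →
      g ∈ Serre1972.unitGroup (Serre1972.adjoinElem (g₀ : Matrix (Fin 2) (Fin 2) (ZMod p)))) :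
    ∃ w : Fin 2 → AlgebraicClosure (ZMod p), w ≠ 0 ∧
      ∀ g ∈ G, IsSquare (g : Matrix (Fin 2) (Fin 2) (ZMod p)).det →
        ∃ a : AlgebraicClosure (ZMod p),
          ((g : Matrix (Fin 2) (Fin 2) (ZMod p)).map
            (algebraMap (ZMod p) (AlgebraicClosure (ZMod p)))) *ᵥ w = a • w := by
  classical
  set φ : ZMod p →+* AlgebraicClosure (ZMod p) := algebraMap (ZMod p) (AlgebraicClosure (ZMod p))
    with hφ
  set M : Matrix (Fin 2) (Fin 2) (AlgebraicClosure (ZMod p)) :=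
    (g₀ : Matrix (Fin 2) (Fin 2) (ZMod p)).map φ with hM
  obtain ⟨μ, hμ⟩ := Module.End.exists_eigenvalue (Matrix.toLin' M)
  obtain ⟨w, hw⟩ := hμ.exists_hasEigenvector
  have hMw : M *ᵥ w = μ • w := by
    rw [← Matrix.toLin'_apply]; exact hw.apply_eq_smul
  refine ⟨w, (Module.End.hasEigenvector_iff.mp hw).2, fun g hg hsq ↦ ?_⟩
  obtain ⟨a, b, hab⟩ := Serre1972.mem_adjoinElem_iff.mp
    (Serre1972.mem_unitGroup_iff.mp (hmem g hg hsq))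
  refine ⟨φ a + φ b * μ, ?_⟩
  have hmap : (g : Matrix (Fin 2) (Fin 2) (ZMod p)).map φ =
      φ a • (1 : Matrix (Fin 2) (Fin 2) (AlgebraicClosure (ZMod p))) + φ b • M := by
    rw [hab]
    ext i j
    simp [hM, Matrix.map_apply, Matrix.one_apply, apply_ite φ]
  rw [hmap, Matrix.add_mulVec, Matrix.smul_mulVec, Matrix.smul_mulVec,
    Matrix.one_mulVec, hMw, smul_smul, ← add_smul]

/-- **A1-img (PROVED; the Cartan step).** For `ρ̄ : Γ_ℚ → GL₂(𝔽_p)`, `p` odd, irreducible with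
`det ρ̄ = χ̄_p`: if `ρ̄|Γ_{ℚ(ζ_p)}` is absolutely REDUCIBLE then the square-determinant part of the
image has a common eigenvector over `𝔽̄_p` — FLS Lemma 3.2 (odd form,
`FLS2015.exists_le_normalizer_unitGroup_adjoinElem`: the image sits in the normaliser of a Cartan
`C = 𝔽_p[g₀]ˣ` with `g ∈ C ↔ det g ∈ (𝔽_pˣ)²`) fed by `exists_eigenvector_of_det_eq_one_of_not_isAbsolutelyIrreducible_restrictField`
(FLS Prop. 3.1 (i)), complex conjugation (`exists_mul_self_eq_one_and_det_eq_neg_one_of_det_eq`)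
and `χ̄_p(Γ_ℚ) = 𝔽_pˣ` (`modPCyclotomicCharacterZMod_rat_surjective`); then A1-grp. -/
theorem exists_common_eigenvector_sq_det_of_not_isAbsolutelyIrreducible_cyclotomic {p : ℕ}
    [Fact p.Prime] (hp2 : p ≠ 2) (ρ : ModPGaloisRep ℚ (ZMod p) 2)
    (hdet : ∀ σ : Field.absoluteGaloisGroup ℚ,
      Matrix.GeneralLinearGroup.det (ρ σ) = modPCyclotomicCharacterZMod ℚ p σ)
    (hirr : FramedRep.IsIrreducible ρ)
    (L : Type) [Field L] [Algebra ℚ L] [IsCyclotomicExtension {p} ℚ L]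
    (hred : ¬ FramedRep.IsAbsolutelyIrreducible (FramedGaloisRep.restrictField L ρ)) :
    ∃ w : Fin 2 → AlgebraicClosure (ZMod p), w ≠ 0 ∧
      ∀ σ : Field.absoluteGaloisGroup ℚ,
        IsSquare ((ρ σ : GL (Fin 2) (ZMod p)) : Matrix (Fin 2) (Fin 2) (ZMod p)).det →
          ∃ a : AlgebraicClosure (ZMod p),
            (((ρ σ : GL (Fin 2) (ZMod p)) : Matrix (Fin 2) (Fin 2) (ZMod p)).map
              (algebraMap (ZMod p) (AlgebraicClosure (ZMod p)))) *ᵥ w = a • w := by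
  haveI : NeZero ((p : ℕ) : ℚ) := ⟨by exact_mod_cast (Fact.out : p.Prime).ne_zero⟩
  obtain ⟨B, _, f, v, hv, hB⟩ :=
    exists_eigenvector_of_det_eq_one_of_not_isAbsolutelyIrreducible_restrictField ρ hdet L hred
  obtain ⟨c, hcc, hcdet⟩ :=
    exists_mul_self_eq_one_and_det_eq_neg_one_of_det_eq ρ hdet (Rat.castHom ℝ)
  obtain ⟨g₀, -, -, -, -, -, hmem⟩ :=
    FLS2015.exists_le_normalizer_unitGroup_adjoinElem (G := ρ.toMonoidHom.range) hp2
      (FLS2015.range_irreducible ρ hirr) f hv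
      (by rintro _ ⟨σ, rfl⟩ hσ; exact hB σ hσ) (c := ρ c) ⟨c, rfl⟩ hcc hcdet
      (FLS2015.range_det_surjective ρ hdet (modPCyclotomicCharacterZMod_rat_surjective p))
  obtain ⟨w, hw, hW⟩ := exists_common_eigenvector_of_mem_unitGroup_adjoinElem
    (G := ρ.toMonoidHom.range) (g₀ := g₀) (fun g hg hsq ↦ (hmem g hg).mpr hsq)
  exact ⟨w, hw, fun σ hsq ↦ hW (ρ σ) ⟨σ, rfl⟩ hsq⟩

/-- `x² = 1 ⇒ x` is a square in `𝔽₅` (`±1 = 1², 2²`). -/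
theorem isSquare_of_sq_eq_one_zmod_five : ∀ x : ZMod 5, x ^ 2 = 1 → IsSquare x := by decide

/-- **A1-sqrt (PROVED; the `ℚ(√5)` side).** If the square-determinant part of `ρ̄(Γ_ℚ)`
(`det ρ̄ = χ̄₅`) has a common eigenvector over `𝔽̄₅`, then `ρ̄|Γ_{ℚ(√5)}` is absolutely
REDUCIBLE: `χ̄₅(Γ_{ℚ(√5)})² = 1` (`modPCyclotomicCharacterZMod_five_sq_eq_one_of_isSquare`,
`modPCyclotomicCharacterZMod_absGaloisRestrict`), so `ρ̄(Γ_{ℚ(√5)})` lies in the square-determinant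
part, contradicting `OpenImage.exists_not_eigenline_of_isAbsolutelyIrreducible`. -/
theorem not_isAbsolutelyIrreducible_restrictField_sqrt_five_of_common_eigenvector
    (ρ : ModPGaloisRep ℚ (ZMod 5) 2)
    (hdet : ∀ σ : Field.absoluteGaloisGroup ℚ,
      Matrix.GeneralLinearGroup.det (ρ σ) = modPCyclotomicCharacterZMod ℚ 5 σ)
    (M : Type) [Field M] [Algebra ℚ M] [IsSplittingField ℚ M (X ^ 2 - C (5 : ℚ))]
    {w : Fin 2 → AlgebraicClosure (ZMod 5)} (hw : w ≠ 0)
    (hW : ∀ σ : Field.absoluteGaloisGroup ℚ,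
      IsSquare ((ρ σ : GL (Fin 2) (ZMod 5)) : Matrix (Fin 2) (Fin 2) (ZMod 5)).det →
        ∃ a : AlgebraicClosure (ZMod 5),
          (((ρ σ : GL (Fin 2) (ZMod 5)) : Matrix (Fin 2) (Fin 2) (ZMod 5)).map
            (algebraMap (ZMod 5) (AlgebraicClosure (ZMod 5)))) *ᵥ w = a • w) :
    ¬ FramedRep.IsAbsolutelyIrreducible (FramedGaloisRep.restrictField M ρ) := by
  intro hM
  haveI : Fact (Nat.Prime 5) := ⟨by norm_num⟩
  haveI : CharZero M := charZero_of_injective_algebraMap (algebraMap ℚ M).injective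
  haveI : NeZero ((5 : ℕ) : M) := NeZero.charZero
  -- `5` is a square in `M = ℚ(√5)`
  have h5 : IsSquare (5 : M) := by
    set q : ℚ[X] := X ^ 2 - C (5 : ℚ) with hq
    have hq0 : q ≠ 0 := (monic_X_pow_sub_C (5 : ℚ) two_ne_zero).ne_zero
    have hdeg : q.natDegree = 2 := by rw [hq]; exact natDegree_X_pow_sub_C
    obtain ⟨α, hα⟩ : ∃ α : M, aeval α q = 0 := by
      have hd : (q.map (algebraMap ℚ M)).degree ≠ 0 := by
        rw [degree_map, degree_eq_natDegree hq0, hdeg]; decide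
      obtain ⟨α, hα⟩ := (IsSplittingField.splits M q).exists_eval_eq_zero hd
      exact ⟨α, by rwa [aeval_def, eval₂_eq_eval_map]⟩
    have hα2 : α ^ 2 = 5 := by
      have := hα; rw [hq, map_sub, map_pow, aeval_X, aeval_C, sub_eq_zero] at this
      simpa using this
    exact ⟨α, by rw [← sq, hα2]⟩
  obtain ⟨γ, hγ⟩ := OpenImage.exists_not_eigenline_of_isAbsolutelyIrreducible hM
    (algebraMap (ZMod 5) (AlgebraicClosure (ZMod 5))) w hw
  refine hγ ?_
  rw [FramedGaloisRep.restrictField_apply]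
  refine hW _ ?_
  have h1 : modPCyclotomicCharacterZMod ℚ 5 (absGaloisRestrict ℚ M γ) ^ 2 = 1 := by
    rw [modPCyclotomicCharacterZMod_absGaloisRestrict ℚ M 5 γ]
    exact modPCyclotomicCharacterZMod_five_sq_eq_one_of_isSquare M h5 γ
  rw [← hdet (absGaloisRestrict ℚ M γ)] at h1
  refine isSquare_of_sq_eq_one_zmod_five _ ?_
  rw [← Matrix.GeneralLinearGroup.val_det_apply, ← Units.val_pow_eq_pow_val, h1, Units.val_one]

/-- **A1 (Galois form; PROVED).** For `ρ̄ : Γ_ℚ → GL₂(𝔽₅)` with `det ρ̄ = χ̄₅`: absolutely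
irreducible over `ℚ(√5)` ⇒ absolutely irreducible over `ℚ(ζ₅)` (FLS 2015, proof of Prop. 9.1 (c) /
Lemma 3.2; here = A1-img + A1-sqrt). -/
theorem isAbsolutelyIrreducible_restrictField_cyclotomic_of_isAbsIrreducibleOverSqrt_five
    (ρ : ModPGaloisRep ℚ (ZMod 5) 2)
    (hdet : ∀ σ : Field.absoluteGaloisGroup ℚ,
      Matrix.GeneralLinearGroup.det (ρ σ) = modPCyclotomicCharacterZMod ℚ 5 σ)
    (h : ρ.IsAbsIrreducibleOverSqrt 5)
    (L : Type) [Field L] [Algebra ℚ L] [IsCyclotomicExtension {5} ℚ L] :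
    FramedRep.IsAbsolutelyIrreducible (FramedGaloisRep.restrictField L ρ) := by
  haveI : Fact (Nat.Prime 5) := ⟨by norm_num⟩
  by_contra hred
  obtain ⟨w, hw, hW⟩ :=
    exists_common_eigenvector_sq_det_of_not_isAbsolutelyIrreducible_cyclotomic (by decide) ρ hdet
      h.isAbsolutelyIrreducible.isIrreducible L hred
  have key := @not_isAbsolutelyIrreducible_restrictField_sqrt_five_of_common_eigenvector ρ hdet
    (X ^ 2 - C (5 : ℚ) : ℚ[X]).SplittingField _ (_) (IsSplittingField.splittingField _) w hw hW
  exact key (@h (X ^ 2 - C (5 : ℚ) : ℚ[X]).SplittingField _ (_) (IsSplittingField.splittingField _))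

/-- **Conjugation invariance of absolute irreducibility (PROVED; plane case, vector proof).**
Shared helper with the sibling stub files (`liftThree` D1b, `modThree`): there it is a `sorry`. -/
theorem isAbsolutelyIrreducible_conj {G : Type*} [Group G] [TopologicalSpace G] {A : Type}
    [Field A] [TopologicalSpace A] [IsTopologicalRing A] {ρ : FramedRep G A 2}
    (h : ρ.IsAbsolutelyIrreducible) (P : GL (Fin 2) A) :
    (FramedRep.conj P ρ).IsAbsolutelyIrreducible := by
  by_contra hnot
  obtain ⟨B, _, f, v, hv, hB⟩ := FramedRep.exists_eigenvector_of_not_isAbsolutelyIrreducible _ hnot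
  set Q : Matrix (Fin 2) (Fin 2) B := ((P⁻¹ : GL (Fin 2) A) : Matrix (Fin 2) (Fin 2) A).map f
    with hQ
  set Pm : Matrix (Fin 2) (Fin 2) B := ((P : GL (Fin 2) A) : Matrix (Fin 2) (Fin 2) A).map f
    with hPm
  have hQP : Q * Pm = 1 := by
    rw [hQ, hPm, ← Matrix.map_mul, ← Units.val_mul, inv_mul_cancel, Units.val_one,
      Matrix.map_one f (map_zero f) (map_one f)]
  have hPQ : Pm * Q = 1 := by
    rw [hQ, hPm, ← Matrix.map_mul, ← Units.val_mul, mul_inv_cancel, Units.val_one,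
      Matrix.map_one f (map_zero f) (map_one f)]
  have hv' : Q *ᵥ v ≠ 0 := by
    intro h0
    apply hv
    have h1 := congrArg (fun x ↦ Pm *ᵥ x) h0
    simpa only [Matrix.mulVec_mulVec, hPQ, Matrix.one_mulVec, Matrix.mulVec_zero] using h1
  obtain ⟨γ, hγ⟩ := OpenImage.exists_not_eigenline_of_isAbsolutelyIrreducible h f (Q *ᵥ v) hv'
  apply hγ
  obtain ⟨c, hc⟩ := hB γ
  refine ⟨c, ?_⟩
  rw [FramedRep.conj_apply, Units.val_mul, Units.val_mul, Matrix.map_mul, Matrix.map_mul] at hc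
  have h2 := congrArg (fun x ↦ Q *ᵥ x) hc
  simp only [Matrix.mulVec_mulVec, Matrix.mulVec_smul] at h2
  rw [← Matrix.mul_assoc, ← Matrix.mul_assoc, hQP, Matrix.one_mul] at h2
  rw [Matrix.mulVec_mulVec]
  exact h2

/-- **A1 (curve form = hypothesis (ii) of FLS Thm. 2 at `K = ℚ`, `p = 5`; PROVED).** The
determinant is read on any elliptic `W/ℚ` framed by `ρ̄`
(`det_eq_modPCyclotomicCharacter_of_isTorsionGaloisRep_holds`); all framings of `E'[5]` are
conjugate (`IsTorsionGaloisRep.exists_conj_eq`) and absolute irreducibility is conjugation-invariant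
(`isAbsolutelyIrreducible_conj`). -/
theorem modPImageAbsIrreducibleOverCyclotomic_five_of_isAbsIrreducibleOverSqrt
    (W : WeierstrassCurve ℚ) [W.IsElliptic] (E' : WeierstrassCurve ℚ)
    (ρ : ModPGaloisRep ℚ (ZMod 5) 2) (hρW : W.IsTorsionGaloisRep 5 ρ)
    (hρE' : E'.IsTorsionGaloisRep 5 ρ) (h : ρ.IsAbsIrreducibleOverSqrt 5) :
    ModPImageAbsIrreducibleOverCyclotomic E' 5 := by
  intro ρ₁ hρ₁ L _ _ _
  have hdet : ∀ σ : Field.absoluteGaloisGroup ℚ,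
      Matrix.GeneralLinearGroup.det (ρ σ) = modPCyclotomicCharacterZMod ℚ 5 σ :=
    W.det_eq_modPCyclotomicCharacter_of_isTorsionGaloisRep_holds 5 ρ hρW
  obtain ⟨P, rfl⟩ := hρE'.exists_conj_eq hρ₁
  have hL :=
    isAbsolutelyIrreducible_restrictField_cyclotomic_of_isAbsIrreducibleOverSqrt_five ρ hdet h L
  have heq : FramedGaloisRep.restrictField L (FramedRep.conj P ρ) =
      FramedRep.conj P (FramedGaloisRep.restrictField L ρ) := rfl
  rw [heq]
  exact isAbsolutelyIrreducible_conj hL P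

/-! ### D1, D2′, D4a, D4 -/

/-- **D1 (integral model; PROVED).** Every elliptic `W/ℚ` is `C • (E ⊗ ℚ)` for an integral model
`E / 𝓞 ℚ` with `Δ(E) ≠ 0`, and every framing of `W[n]` frames `(E ⊗ ℚ)[n]`. -/
theorem exists_integralModel (W : WeierstrassCurve ℚ) [W.IsElliptic] :
    ∃ (E : WeierstrassCurve (𝓞 ℚ)) (C : VariableChange ℚ),
      C • E.baseChange ℚ = W ∧ E.Δ ≠ 0 ∧
      ∀ (n : ℕ) [Fact n.Prime] (ρ : ModPGaloisRep ℚ (ZMod n) 2),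
        W.IsTorsionGaloisRep n ρ → (E.baseChange ℚ).IsTorsionGaloisRep n ρ := by
  obtain ⟨C, hC⟩ := hasGlobalMinimalModel_rat_holds W
  haveI := hC
  refine ⟨(C • W).integralModel (𝓞 ℚ), C⁻¹, ?_, IsGloballyMinimal.Δ_ne_zero (C • W),
    fun n _ ρ hρ ↦ ?_⟩
  · rw [baseChange_integralModel_eq (𝓞 ℚ) (C • W), inv_smul_smul]
  · rw [baseChange_integralModel_eq (𝓞 ℚ) (C • W)]
    exact MatarNekovar2019.isTorsionGaloisRep_smul W C hρ

/-- **D2′ (residual Hilbert-modularity of a MODULAR curve's `5`-torsion; PROVED).** `π` from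
`exists_hasWeightZero_satake_of_isNewformOf` (Gelbart's dictionary, PROVED; `O = ℤ`,
`t = a_v(W')`, `s = q_v`), the Satake identity IS `HasHeckePolynomialAt` by definition; Galois
side `IsTorsionGaloisRep.isUnramifiedAt_of_hasGoodReductionAt` / `charpoly_eq_of_isArithFrobAt` at
the cofinitely many good `v ∤ 5` (template: `IsTorsionGaloisRep.isHilbertModular`). -/
theorem isHilbertModular_of_isModular_curve (W' : WeierstrassCurve ℚ) [W'.IsElliptic]
    [NeZero (W'.conductorNorm ℤ)] (hW' : BCDT.IsModular W') (ρ : ModPGaloisRep ℚ (ZMod 5) 2)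
    (hρ : W'.IsTorsionGaloisRep 5 ρ) : ρ.IsHilbertModular := by
  haveI : Fact (Nat.Prime 5) := ⟨by norm_num⟩
  obtain ⟨f, hf⟩ := hW'
  have hcpt : isCompact_glFiniteIntegralLevel 2 ℚ := isCompact_glFiniteIntegralLevel_holds 2 ℚ
  obtain ⟨π, h0, hsat⟩ := exists_hasWeightZero_satake_of_isNewformOf W' hf hcpt
  refine ⟨hcpt, π, ℤ, inferInstance, Int.castRingHom ℂ, Int.castRingHom (ZMod 5),
    Int.cast_injective, h0, ?_⟩
  filter_upwards [hsat, W'.eventually_hasGoodReductionAt,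
    Literature.NumberTheory.Automorphic.eventually_natCast_not_mem_asIdeal ℚ
      (show (5 : ℕ) ≠ 0 by norm_num)] with v hv hgood hv5
  obtain ⟨α, hα, hpol⟩ := hv
  refine ⟨W'.frobeniusTraceAt v, (v.residueCard : ℤ), ⟨α, hα, ?_⟩,
    hρ.isUnramifiedAt_of_hasGoodReductionAt hgood hv5, ?_⟩
  · -- the Hecke polynomial is the Satake polynomial at `q^{1/2} α`
    rw [satakePolynomial, Multiset.map_map, eq_intCast, eq_intCast, Int.cast_natCast, ← hpol]
    refine congrArg Multiset.prod (Multiset.map_congr rfl fun z _ ↦ ?_)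
    simp
  · -- arithmetic Frobenius on `W'[5]`: `X² - ā_v X + q̄_v`
    intro 𝔓 h𝔓 σ hσ
    have h := hρ.charpoly_eq_of_isArithFrobAt
      (W'.trace_galoisRepTate_frobenius_of_hasGoodReductionAt_holds 5)
      (W'.det_galoisRepTate_frobenius_of_hasGoodReductionAt_holds 5) hv5 hgood h𝔓 hσ
    rw [WeierstrassCurve.natCard_residueField_eq_residueCard] at h
    rw [FramedRep.charpoly, h, eq_intCast, eq_intCast, Int.cast_natCast]

/-- **D4a (weight-zero `π` of `GL₂(𝔸_ℚ)` ↦ newform on `Γ₀`; L — the ONE residual debt of Plan A's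
congruence road).** A weight-zero cuspidal `π` of `GL₂(𝔸_ℚ)` with Hecke polynomials
`X² - a_w(E) X + q_w` at all `w ∤ Δ(E)` comes from a newform `g ∈ S₂(Γ₀(M))` with
`a_q(g) = a_q(E ⊗ ℚ)` off `M · R`: (arch) trivial central character (constant terms `q_w`) + the
weight-zero infinitesimal character force `π_∞ = D₂` (Gelbart Rem. 2.5.5 read backwards, as the
tree does in weight one: `GL2WeightVectors`, `NewformAdelisationDescentHolomorphy`); (fin) new
vector = `CuspidalAutomorphicRepData.exists_gammaOneFiniteLevel_fixed` (PROVED, Casselman 1973);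
Atkin–Lehner to a newform (`exists_isNewform1_of_mem_newSubspace1`); `a_q(g) = q^{1/2} Σ α` by
strong multiplicity one off the level.  Port of `IsOfWeightOne.exists_isNewform1_of_exists_fixed`
to weight 2. -/
theorem exists_isNewform0_of_isAutomorphicOfWeightZero_rat (E : WeierstrassCurve (𝓞 ℚ))
    (hΔ : E.Δ ≠ 0) (hE : IsAutomorphicOfWeightZero E) :
    ∃ (M : ℕ) (_ : NeZero M) (g : CuspForm (CongruenceSubgroup.Gamma0 M) 2), IsNewform0 g ∧
      ∃ (R : ℕ) (_ : NeZero R), ∀ q : ℕ, q.Prime → ¬ q ∣ M * R →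
        cuspCoeff g q = ((E.baseChange ℚ).LFunction q : ℂ) := by
  sorry

/-- **D4 = D4a + Serre 1987 §4.6 (tree: `isModular_of_isNewform0_of_cuspCoeff_eq_off_of_three_facts`,
Faltings discharged by `isIsogenous_iff_frobeniusTrace_eq_holds`; ES + Carayol granted — already in
the line's trust base) + `IsModular.isModularGaloisRepTate` + `LFunction_smul`.  PROVED mod D4a. -/
theorem isModularGaloisRepTate_of_isAutomorphicOfWeightZero (hES : eichlerShimuraConstruction)
    (hC : ∀ (N : ℕ) [NeZero N], IsNewformOf.level_eq_conductorNorm (N := N))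
    (E : WeierstrassCurve (𝓞 ℚ)) (W : WeierstrassCurve ℚ) [W.IsElliptic] (C : VariableChange ℚ)
    (hCW : C • E.baseChange ℚ = W) (hΔ : E.Δ ≠ 0) (hE : IsAutomorphicOfWeightZero E) :
    W.IsModularGaloisRepTate 5 := by
  haveI : NeZero (W.conductorNorm ℤ) := ⟨(conductorNorm_pos_holds W).ne'⟩
  haveI : Fact (Nat.Prime 5) := ⟨by norm_num⟩
  haveI : (E.baseChange ℚ).IsElliptic := by
    rw [WeierstrassCurve.isElliptic_iff, WeierstrassCurve.baseChange, WeierstrassCurve.map_Δ,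
      isUnit_iff_ne_zero]
    exact (map_ne_zero_iff _ (IsFractionRing.injective (𝓞 ℚ) ℚ)).2 hΔ
  obtain ⟨M, _, g, hg, R, _, h⟩ := exists_isNewform0_of_isAutomorphicOfWeightZero_rat E hΔ hE
  have hLW : W.LFunction = (E.baseChange ℚ).LFunction := by
    rw [← hCW, WeierstrassCurve.LFunction_smul]
  have h' : ∀ q : ℕ, q.Prime → ¬ q ∣ M * R → cuspCoeff g q = (W.LFunction q : ℂ) := by
    intro q hq hqMR
    rw [hLW]
    exact h q hq hqMR
  exact (isModular_of_isNewform0_of_cuspCoeff_eq_off_of_three_facts hES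
    isIsogenous_iff_frobeniusTrace_eq_holds hC W hg h').isModularGaloisRepTate 5

/-- **Plan A, CONGRUENCE form (what `isModular_freyCurve_of_stubs` actually feeds: `E[5] ≅ E′[5]`
with `E′` a modular CURVE) — kernel-checked modulo D4a ALONE (A1, D1, D2′, D4 proved); trust base
{`FLS2015_theorem2`, ES, Carayol}; `25 ∤ N` unused.** -/
theorem liftFive_congruence_of_FLS2015_theorem2 (hFLS : FLS2015_theorem2)
    (hES : eichlerShimuraConstruction)
    (hC : ∀ (N : ℕ) [NeZero N], IsNewformOf.level_eq_conductorNorm (N := N))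
    (W : WeierstrassCurve ℚ) [W.IsElliptic] (W' : WeierstrassCurve ℚ) [W'.IsElliptic]
    [NeZero (W'.conductorNorm ℤ)] (ρ : ModPGaloisRep ℚ (ZMod 5) 2)
    (hρ : W.IsTorsionGaloisRep 5 ρ) (hρW' : W'.IsTorsionGaloisRep 5 ρ)
    (hirr : ρ.IsAbsIrreducibleOverSqrt 5) (hW' : BCDT.IsModular W') :
    W.IsModularGaloisRepTate 5 := by
  haveI : Fact (Nat.Prime 5) := ⟨by norm_num⟩
  obtain ⟨E, C, hCW, hΔ, htors⟩ := exists_integralModel W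
  have hρE : (E.baseChange ℚ).IsTorsionGaloisRep 5 ρ := htors 5 ρ hρ
  have himg : ModPImageAbsIrreducibleOverCyclotomic (E.baseChange ℚ) 5 :=
    modPImageAbsIrreducibleOverCyclotomic_five_of_isAbsIrreducibleOverSqrt W (E.baseChange ℚ) ρ hρ
      hρE hirr
  have hmod₀ : ρ.IsHilbertModular := isHilbertModular_of_isModular_curve W' hW' ρ hρW'
  exact isModularGaloisRepTate_of_isAutomorphicOfWeightZero hES hC E W C hCW hΔ
    (hFLS.of_exists ℚ E hΔ 5 (by decide) ⟨ρ, hρE, hmod₀⟩ himg)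

/-- **D2 (weight-two realisation of an abstractly modular `ρ̄`; L — needed ONLY for the stub AS
TYPED, i.e. with `ρ.IsModular` = "some newform of some weight").**  Refined Serre
(`diamond1995_refinedSerre` / Edixhoven, named facts) puts `ρ̄` in weight `k(ρ̄) ∈ {2, 6}`,
prime-to-`5` level; `k = 6 = p + 1` ↦ weight `2`, level `5N` (Serre 1987 §3 / Ash–Stevens Thm. 3.5;
cf. the tree's converse `serreWeight_eq_two_or_eq_add_one_of_weightTwo_newform_dvd_level`); then
Gelbart's dictionary as in D2′.  Killed by the CONGRUENCE reshape (recommended). -/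
def WeightTwoRealisationFive : Prop :=
  ∀ ρ : ModPGaloisRep ℚ (ZMod 5) 2, FramedRep.IsAbsolutelyIrreducible ρ → ρ.IsModular →
    ρ.IsHilbertModular

/-- **Plan A for the stub AS TYPED** (kernel-checked modulo D4a and the weight-two realisation D2). -/
theorem stub_liftFive_of_planA (hFLS : FLS2015_theorem2) (hES : eichlerShimuraConstruction)
    (hC : ∀ (N : ℕ) [NeZero N], IsNewformOf.level_eq_conductorNorm (N := N))
    (hD2 : WeightTwoRealisationFive) : Sig := by
  intro W _ ρ hρ hirr _h25 hmod
  haveI : Fact (Nat.Prime 5) := ⟨by norm_num⟩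
  obtain ⟨E, C, hCW, hΔ, htors⟩ := exists_integralModel W
  have hρE : (E.baseChange ℚ).IsTorsionGaloisRep 5 ρ := htors 5 ρ hρ
  have himg : ModPImageAbsIrreducibleOverCyclotomic (E.baseChange ℚ) 5 :=
    modPImageAbsIrreducibleOverCyclotomic_five_of_isAbsIrreducibleOverSqrt W (E.baseChange ℚ) ρ hρ
      hρE hirr
  exact isModularGaloisRepTate_of_isAutomorphicOfWeightZero hES hC E W C hCW hΔ
    (hFLS.of_exists ℚ E hΔ 5 (by decide) ⟨ρ, hρE, hD2 ρ hirr.isAbsolutelyIrreducible hmod⟩ himg)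

/-! ## Plan B — Serre's conjecture at the CANONICAL local datum; the stub without `CDT_theorem_7_2_2` -/

section SerreRoad

open ValuativeRel Literature.NumberTheory.GaloisRepresentations.ModPGaloisRep
open Literature.NumberTheory.GaloisRepresentations.IsNonarchimedeanLocalField
open Literature.NumberTheory.DiophantineGeometry Literature.NumberTheory.EllipticCurves.SkinnerUrban2014
open Rat.HeightOneSpectrum

/-- Khare–Wintenberger at every prime (the road's `hKW`). -/
def KWAll : Prop :=
  ∀ (p : ℕ) [Fact p.Prime] (k : Type) [Field k] [TopologicalSpace k] [DiscreteTopology k],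
    khare_wintenberger p k

/-- The weight hypothesis of Serre's road AT THE CANONICAL LOCAL DATUM `(ℚ_v, ρ̄|Γ_{ℚ_v})`,
`v` the place above `p`. -/
def SerreWeightTwoCanonical : Prop :=
  ∀ (W : WeierstrassCurve ℚ) [W.IsElliptic], ∃ p₀ : ℕ, ∀ (p : ℕ) [Fact p.Prime], p₀ ≤ p →
    ∀ ρ : ModPGaloisRep ℚ (ZMod p) 2, W.IsTorsionGaloisRep p ρ →
      ∀ (k : Type) [Field k] [TopologicalSpace k] [DiscreteTopology k] (j : ZMod p →+* k)
        (v : HeightOneSpectrum (𝓞 ℚ)) (hpv : (p : 𝓞 ℚ) ∈ v.asIdeal)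
        (ι : absIntegers 𝒪[v.adicCompletion ℚ] (v.adicCompletion ℚ) ⧸
          absMaximalIdeal (v.adicCompletion ℚ) →+* k),
        serreWeight p (FramedRep.baseChange j continuous_of_discreteTopology ρ)
          { F := v.adicCompletion ℚ
            residueFieldCard_eq := residueFieldCard_adicCompletion_eq_of_natCast_mem hpv
            irreducible_natCast :=
              irreducible_natCast_valuativeInteger_adicCompletion_of_natCast_mem hpv
            rep := FramedGaloisRep.restrictField (v.adicCompletion ℚ)
              (FramedRep.baseChange j continuous_of_discreteTopology ρ)
            rep_eq_restrictField := rfl } ι = 2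

/-- **B2 (PROVED): the canonical weight hypothesis holds** — for `p > N_W + 2`, `W` has good
reduction at `v ∣ p` and Serre's recipe gives weight `2` there
(`serreWeight_eq_two_of_hasGoodReductionAt`). -/
theorem serreWeightTwoCanonical_holds : SerreWeightTwoCanonical := by
  intro W _
  refine ⟨W.conductorNorm ℤ + 3, fun p _ hp ρ hρ k _ _ _ j v hpv ι ↦ ?_⟩
  have hp2 : p ≠ 2 := by omega
  have hv : ((primesEquiv v : Nat.Primes) : ℕ) = p :=
    (natCast_mem_asIdeal_iff_primesEquiv_eq v Fact.out).mp hpv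
  have hndvd : ¬ ((primesEquiv v : Nat.Primes) : ℕ) ∣ W.conductorNorm ℤ := by
    rw [hv]
    exact Nat.not_dvd_of_pos_of_lt (W.conductorNorm_pos_holds) (by omega)
  exact serreWeight_eq_two_of_hasGoodReductionAt W p hp2 v hpv
    (hasGoodReductionAt_of_not_dvd_conductorNorm W v hndvd) hρ k j ι

/-- **B1″ (Serre's (3.3.1) for `ρ̄_{E,p}`, `p` large, from KW with the weight read at the
CANONICAL datum; PROVED — Plan B has NO residual sorry).**  Literally Step 2 of
`forall_isTorsionGaloisRep_exists_isNewform1_of_khare_wintenberger` (`CDTTheorem722SerreProofs`,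
≈ 45 lines) with `obtain ⟨loc⟩ := nonempty_localRestrictionAt p ρ'` replaced by the canonical
datum at `v := primesEquiv.symm ⟨p, _⟩` (`natCast_mem_asIdeal_iff_primesEquiv_eq`; residue
embedding by `nonempty_ringHom_residue`), exactly as
`ribet1997_twoPowerFermat_of_khare_wintenberger_of_freyOggSaito_canonical`
(`GeneralizedFermatTwoPowerCoefficientSerreWeightProofs`) already does for Frey curves. -/
theorem forall_isTorsionGaloisRep_exists_isNewform1_of_khare_wintenberger_canonical
    (W : WeierstrassCurve ℚ) [W.IsElliptic] (p₀ : ℕ)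
    (hKW : ∀ (p : ℕ) [Fact p.Prime], p₀ ≤ p →
      ∀ (k : Type) [Field k] [TopologicalSpace k] [DiscreteTopology k], khare_wintenberger p k)
    (hwt : ∀ (p : ℕ) [Fact p.Prime], p₀ ≤ p →
      ∀ ρ : ModPGaloisRep ℚ (ZMod p) 2, W.IsTorsionGaloisRep p ρ →
        ∀ (k : Type) [Field k] [TopologicalSpace k] [DiscreteTopology k] (j : ZMod p →+* k)
          (v : HeightOneSpectrum (𝓞 ℚ)) (hpv : (p : 𝓞 ℚ) ∈ v.asIdeal)
          (ι : absIntegers 𝒪[v.adicCompletion ℚ] (v.adicCompletion ℚ) ⧸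
            absMaximalIdeal (v.adicCompletion ℚ) →+* k),
          serreWeight p (FramedRep.baseChange j continuous_of_discreteTopology ρ)
            { F := v.adicCompletion ℚ
              residueFieldCard_eq := residueFieldCard_adicCompletion_eq_of_natCast_mem hpv
              irreducible_natCast :=
                irreducible_natCast_valuativeInteger_adicCompletion_of_natCast_mem hpv
              rep := FramedGaloisRep.restrictField (v.adicCompletion ℚ)
                (FramedRep.baseChange j continuous_of_discreteTopology ρ)
              rep_eq_restrictField := rfl } ι = 2)
    (hlev : ∀ (p : ℕ) [Fact p.Prime], p₀ ≤ p →
      ∀ ρ : ModPGaloisRep ℚ (ZMod p) 2, W.IsTorsionGaloisRep p ρ →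
        ∀ (k : Type) [Field k] [TopologicalSpace k] [DiscreteTopology k] [CharP k p]
          [IsAlgClosed k] (j : ZMod p →+* k),
          serreLevel p (FramedRep.baseChange j continuous_of_discreteTopology ρ) ∣
            W.conductorNorm ℤ) :
    ∃ p₁ : ℕ, ∀ (p : ℕ) [Fact p.Prime], p₁ ≤ p →
      ∀ ρ : ModPGaloisRep ℚ (ZMod p) 2, W.IsTorsionGaloisRep p ρ →
        ∃ (N : ℕ) (_ : NeZero N) (_ : N ≤ W.conductorNorm ℤ)
          (f : CuspForm (CongruenceSubgroup.Gamma1 N) 2)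
          (K : Type) (_ : Field K) (_ : CharP K p) (_ : TopologicalSpace K)
          (j : ZMod p →+* K) (ι : coeffCharIntegers f →+* K),
          IsNewform1 f ∧
            IsGaloisRepOfNewform1Int f ι {q | q ∣ N * p}
              (FramedRep.baseChange j continuous_of_discreteTopology ρ) := by
  obtain ⟨n₁, hn₁⟩ := W.exists_forall_hasIrreducibleModPGaloisRep_of_lt
  refine ⟨max (max p₀ 3) (n₁ + 1), fun p _ hp ρ hρ ↦ ?_⟩
  have hpp : p.Prime := Fact.out
  have hp₀ : p₀ ≤ p := (le_max_left _ _).trans ((le_max_left _ _).trans hp)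
  have hp2 : p ≠ 2 := by
    have : 3 ≤ p := (le_max_right _ _).trans ((le_max_left _ _).trans hp)
    omega
  have hpn : n₁ < p := Nat.lt_of_succ_le ((le_max_right _ _).trans hp)
  haveI : NeZero ((p : ℕ) : ℚ) := ⟨by exact_mod_cast hpp.ne_zero⟩
  -- coefficients `𝔽̄_p` with the discrete topology
  letI : TopologicalSpace (AlgebraicClosure (ZMod p)) := ⊥
  haveI : DiscreteTopology (AlgebraicClosure (ZMod p)) := ⟨rfl⟩
  set j : ZMod p →+* AlgebraicClosure (ZMod p) := algebraMap (ZMod p) (AlgebraicClosure (ZMod p))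
    with hj
  set ρ' : ModPGaloisRep ℚ (AlgebraicClosure (ZMod p)) 2 :=
    FramedRep.baseChange j continuous_of_discreteTopology ρ with hρ'
  -- `ρ̄ ⊗ 𝔽̄_p` is irreducible and odd
  have habs := isAbsolutelyIrreducible_of_hasIrreducibleModPGaloisRep W hp2 (hn₁ p hpn hpp) hρ
  have hirr : ρ'.toGaloisRep.IsIrreducible := by
    rw [← ModPGaloisRep.isIrreducible_iff_toGaloisRep]
    exact habs.isIrreducible_baseChange (AlgebraicClosure (ZMod p)) j _
  have hodd : FramedGaloisRep.IsOdd ρ' :=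
    (ModPGaloisRep.isOdd_of_det_eq_modPCyclotomicCharacterZMod ρ
      (W.det_eq_modPCyclotomicCharacter_of_isTorsionGaloisRep_holds p ρ hρ)).baseChange j _
  -- Serre (3.2.4) at the CANONICAL local restriction datum `(ℚ_v, ρ̄'|Γ_{ℚ_v})`, `v ∣ p`
  set v : HeightOneSpectrum (𝓞 ℚ) := (primesEquiv (R := 𝓞 ℚ)).symm ⟨p, hpp⟩ with hv_def
  have hpv : (p : 𝓞 ℚ) ∈ v.asIdeal :=
    (natCast_mem_asIdeal_iff_primesEquiv_eq v hpp).mpr (by rw [hv_def, Equiv.apply_symm_apply])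
  set loc : LocalRestrictionAt p ρ' :=
    { F := v.adicCompletion ℚ
      residueFieldCard_eq := residueFieldCard_adicCompletion_eq_of_natCast_mem hpv
      irreducible_natCast := irreducible_natCast_valuativeInteger_adicCompletion_of_natCast_mem hpv
      rep := FramedGaloisRep.restrictField (v.adicCompletion ℚ) ρ'
      rep_eq_restrictField := rfl } with hloc
  obtain ⟨ι⟩ := nonempty_ringHom_residue (k := AlgebraicClosure (ZMod p)) p (v.adicCompletion ℚ)
    (residueFieldCard_adicCompletion_eq_of_natCast_mem hpv)
  obtain ⟨f, ιf, hf, hgal⟩ := hKW p hp₀ (AlgebraicClosure (ZMod p)) ρ' hirr hodd loc ι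
  have hw : (serreWeight p ρ' loc ι : ℤ) = 2 := by
    have h2 : serreWeight p ρ' loc ι = 2 := hwt p hp₀ ρ hρ (AlgebraicClosure (ZMod p)) j v hpv ι
    rw [h2]; rfl
  have hl : serreLevel p ρ' ∣ W.conductorNorm ℤ := hlev p hp₀ ρ hρ (AlgebraicClosure (ZMod p)) j
  haveI hNz : NeZero (serreLevel p ρ') := ⟨fun h0 ↦ not_dvd_serreLevel p ρ' (h0 ▸ dvd_zero p)⟩
  -- transport along `k(ρ̄) = 2`
  revert hgal hf ιf f
  rw [hw]
  intro f ιf hf hgal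
  exact ⟨serreLevel p ρ', hNz, Nat.le_of_dvd (conductorNorm_pos_holds W) hl, f,
    AlgebraicClosure (ZMod p), inferInstance, inferInstance, ⊥, j, ιf, hf, hgal⟩

/-- **`E` modular along Serre's road with the weight at the canonical datum (PROVED)** —
the corollary chain `…_of_conductorNatOf` / `isModular_of_forall_isTorsionGaloisRep_exists_isNewform1_of_three_facts`
of the tree re-run on B1″ (Faltings `hF` := `isIsogenous_iff_frobeniusTrace_eq_holds`). -/
theorem isModular_of_khare_wintenberger_canonical (hES : eichlerShimuraConstruction)
    (hC : ∀ (N : ℕ) [NeZero N], IsNewformOf.level_eq_conductorNorm (N := N))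
    (hN : ∀ (W : WeierstrassCurve ℚ) (ℓ : ℕ) [Fact ℓ.Prime],
      W.conductorNatOf_geomPoints_eq_conductorNorm_of_isElliptic ℓ)
    (W : WeierstrassCurve ℚ) [W.IsElliptic] [NeZero (W.conductorNorm ℤ)] (p₀ : ℕ)
    (hKW : ∀ (p : ℕ) [Fact p.Prime], p₀ ≤ p →
      ∀ (k : Type) [Field k] [TopologicalSpace k] [DiscreteTopology k], khare_wintenberger p k)
    (hwt : ∀ (p : ℕ) [Fact p.Prime], p₀ ≤ p →
      ∀ ρ : ModPGaloisRep ℚ (ZMod p) 2, W.IsTorsionGaloisRep p ρ →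
        ∀ (k : Type) [Field k] [TopologicalSpace k] [DiscreteTopology k] (j : ZMod p →+* k)
          (v : HeightOneSpectrum (𝓞 ℚ)) (hpv : (p : 𝓞 ℚ) ∈ v.asIdeal)
          (ι : absIntegers 𝒪[v.adicCompletion ℚ] (v.adicCompletion ℚ) ⧸
            absMaximalIdeal (v.adicCompletion ℚ) →+* k),
          serreWeight p (FramedRep.baseChange j continuous_of_discreteTopology ρ)
            { F := v.adicCompletion ℚ
              residueFieldCard_eq := residueFieldCard_adicCompletion_eq_of_natCast_mem hpv
              irreducible_natCast :=
                irreducible_natCast_valuativeInteger_adicCompletion_of_natCast_mem hpv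
              rep := FramedGaloisRep.restrictField (v.adicCompletion ℚ)
                (FramedRep.baseChange j continuous_of_discreteTopology ρ)
              rep_eq_restrictField := rfl } ι = 2) :
    BCDT.IsModular W := by
  obtain ⟨p₁, h⟩ :=
    forall_isTorsionGaloisRep_exists_isNewform1_of_khare_wintenberger_canonical W
      (max p₀ (W.conductorNorm ℤ + 1))
      (fun p _ hp k _ _ _ ↦ hKW p ((le_max_left _ _).trans hp) k)
      (fun p _ hp ρ hρ k _ _ _ j v hpv ι ↦ hwt p ((le_max_left _ _).trans hp) ρ hρ k j v hpv ι)
      (fun p _ hp ρ hρ k _ _ _ _ _ j ↦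
        serreLevel_baseChange_dvd_conductorNorm_of_conductorNatOf hN W p
          (Nat.lt_of_succ_le ((le_max_right _ _).trans hp)) ρ hρ k j)
  exact isModular_of_forall_isTorsionGaloisRep_exists_isNewform1_of_three_facts hES
    isIsogenous_iff_frobeniusTrace_eq_holds hC W (W.conductorNorm ℤ) p₁
    (fun p _ hp ρ hρ ↦ h p hp ρ hρ)

/-- **By-product (SORRY-FREE): Serre's conjecture ⇒ every elliptic curve over `ℚ` is modular**
(Serre 1987 §4.6 Thm. 4), granted the four named facts {`khare_wintenberger` (all `p`, `k`), the
`ℓ`-adic conductor compatibility `hN`, Eichler–Shimura, Carayol} — the tree's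
`isModular_of_khare_wintenberger_of_serreWeight_of_conductorNatOf_of_three_facts` with its weight
hypothesis `hwt` now DISCHARGED (B2 + B1″).  A line-level conditional closer of the whole crux
(`FreyModularity`) follows; flagged for the lead, not this seat's call. -/
theorem isModular_of_KWAll (hKW : KWAll)
    (hN : ∀ (W : WeierstrassCurve ℚ) (ℓ : ℕ) [Fact ℓ.Prime],
      W.conductorNatOf_geomPoints_eq_conductorNorm_of_isElliptic ℓ)
    (hES : eichlerShimuraConstruction)
    (hC : ∀ (N : ℕ) [NeZero N], IsNewformOf.level_eq_conductorNorm (N := N))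
    (W : WeierstrassCurve ℚ) [W.IsElliptic] [NeZero (W.conductorNorm ℤ)] : BCDT.IsModular W := by
  obtain ⟨p₀, hwt⟩ := serreWeightTwoCanonical_holds W
  exact isModular_of_khare_wintenberger_canonical hES hC hN W p₀ (fun p _ _ k _ _ _ ↦ hKW p k) hwt

/-- **Plan B closer (SORRY-FREE; kernel-checked): trust base {`khare_wintenberger`, the `ℓ`-adic
conductor fact `hN`, ES, Carayol}; `hwt` DISCHARGED by B2; `CDT_theorem_7_2_2` BYPASSED
(`IsModular.isModularGaloisRepTate`); `25 ∤ N`, `ρ.IsModular`, `IsAbsIrreducibleOverSqrt` unused.** -/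
theorem stub_liftFive_of_KW (hKW : KWAll)
    (hN : ∀ (W : WeierstrassCurve ℚ) (ℓ : ℕ) [Fact ℓ.Prime],
      W.conductorNatOf_geomPoints_eq_conductorNorm_of_isElliptic ℓ)
    (hES : eichlerShimuraConstruction)
    (hC : ∀ (N : ℕ) [NeZero N], IsNewformOf.level_eq_conductorNorm (N := N)) : Sig := by
  intro W _ ρ _hρ _hirr _h25 _hmod
  haveI : NeZero (W.conductorNorm ℤ) := ⟨(conductorNorm_pos_holds W).ne'⟩
  haveI : Fact (Nat.Prime 5) := ⟨by norm_num⟩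
  exact (isModular_of_KWAll hKW hN hES hC W).isModularGaloisRepTate 5

end SerreRoad

/-! ## Plan 0 — the line's own closer (for reference): `CDT_theorem_7_2_2` ⇒ stub -/

theorem stub_liftFive_of_CDT722 (h : CDT_theorem_7_2_2) : Sig :=
  fun W _ ρ hρ hirr _ hmod ↦ lift_of_CDT_theorem_7_2_2 h W ρ hρ hirr hmod

end Summit.ABC.ABC.Cruxes.FreyModularity.StubIdeas.LiftFive2g3

end
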